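import Summits.NavierStokesRegularity.NavierStokesRegularity.Theorems.StrainDoorsSupTypeIScaledEnergies
import Literature.Analysis.FluidPDE.LocalLerayWeakStrongProofs
import Literature.Analysis.FluidPDE.SerrinEnstrophyGronwall
import Literature.Analysis.FluidPDE.SpaceTimeRescaling
import Literature.Analysis.FluidPDE.ClassicalSolutionRescale
import Literature.Analysis.FluidPDE.LerayHopfNSRescale
import Literature.Analysis.FluidPDE.SelfSimilar
import HarnessLib

/-!
# Strain doors, PART M §M30(a)–(c) — LINK 2 typed (`SlicedLinearLEIUnderRate`) and LINK 3 proved: the sliced linear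
# local energy inequality under the rate implies door X″ (Grönwall at unit scale + Leray rescaling)

ROUND 70 of the `ns-regularity-ideate` programme (p1 line; helper lane of `stmt-NavierStokesRegularity-0056`,
rung N0; nothing here is a claim about Navier–Stokes regularity).  ROUND 69 proved door X′ (the `L²`-Morrey Type-I
bound from the sup-norm rate IN THE ENERGY CLASS, constant `M₂(M, ‖u₀‖₂, T₀)`) and typed door X″
`UlocMorreyBoundSupTypeI`: the same bound with an `M`-ONLY constant at all radii `r² < T`.  ROUND 70 CLOSES X″ by a
uniformly-local energy Grönwall argument under the rate, in three links, ALL PROVED: LINK 1 (the pressure pairing of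
the local energy inequality is LINEAR in the local energies under a sup bound, `M`-free constants — texts N11a/N11b),
LINK 2 (the sliced local energy inequality under the rate at unit scale is linear with `M`-only data — typed in N11c,
PROVED in N11e/N11f/N11g), LINK 3 (LINK 2 ⇒ X″ by Grönwall and Leray rescaling — N11c); N11d puts them together:
`ulocMorreyBoundSupTypeI_holds : UlocMorreyBoundSupTypeI`.

THIS FILE (imports ROUND 69's N10a `StrainDoorsSupTypeIScaledEnergies` for `rate_le_abs_mul_rpow`,
`lintegral_invSqrt_time_le`; tree otherwise):
* §M30(a) the TYPED LINK 2 `SlicedLinearLEIUnderRate` over the tree's `ulocEnergy w = sup_z ∫⁻_{B(z,1)} ‖w‖ₑ²`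
  (a `def … : Prop` without cite tag; PROVED in N11g `slicedLinearLEIUnderRate_holds`);
* §M30(b) `ulocEnergy_le_of_slicedLinearLEI` — Grönwall at unit scale: LINK 2 ⇒
  `sup_z ∫_{B(z,1)} |u(t)|² ≤ A (M² + M³) e^{B₁ + 2B₂M}` on `[T−1, T)` (tree `lintegral_gronwall_le`, RRS 2016
  Lemma A.25, after a time translation; the Leray–Hopf energy closes the loop qualitatively only);
* §M30(c) ★★ `ulocMorreyBound_of_slicedLinearLEI` — LINK 3: LINK 2 ⇒ the body of door X″ (`∀ M ∃ K ∀` classical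
  Leray–Hopf `u` on `[0,T)` with `|u| ≤ M/√(T−t)`, `∀ y`, `0 < r`, `r² < T`, `t ∈ (T − r², T)`:
  `∫_{B(y,r)} |u(t)|² ≤ K r`), by the scale invariance of the rate (`rate_nsRescale`), Leray's rescaling of
  classical and Leray–Hopf solutions (tree `IsClassicalNSSolutionOn.nsRescale_holds`, `isLerayHopfOn_nsRescale`)
  and `setLIntegral_ball_eq_nsRescale`; `K(M) = A (M₊² + M₊³) e^{B₁ + 2B₂M₊}`.
`ulocEnergy` is the TREE's `Literature.Analysis.FluidPDE.ulocEnergy` (LocalLerayWeakStrongProofs; dedup pointer ns-s29-p2 g7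
13:18:09Z).  Helpers: `setLIntegral_ball_le_ulocEnergy`, `ulocEnergy_le_lintegral`, `setLIntegral_Ioo_comp_add_left`,
`lintegral_kernel_le`, `preimage_mul_sq_Ico`.  ONE definition (`SlicedLinearLEIUnderRate`, a typed statement without cite tag)
⇒ S-lane `--kind definition`.  No `sorry`, no new axioms, no instances, no notation.
-/

noncomputable section

set_option linter.dupNamespace false

open MeasureTheory Set Function Filter Metric Real
open _root_.Topology
open scoped ENNReal NNReal RealInnerProductSpace
open Literature.Analysis Literature.Analysis.FluidPDE

namespace Summit.NavierStokesRegularity.NavierStokesRegularity.Theorems.StrainDoors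

/-! ### §M30(a) The uniformly local energy and LINK 2 (typed): the sliced linear local energy
inequality under the Type-I rate, at unit scale

The uniformly local energy at unit scale `ulocEnergy w = sup_z ∫⁻_{B(z,1)} ‖w‖ₑ²` is the TREE's
`Literature.Analysis.FluidPDE.ulocEnergy` (LocalLerayWeakStrongProofs, Lemarié-Rieusset 2016 §14.1); it is used
here at `X = F = ℝ³`. -/

/-- One ball is below the uniformly local energy. [folklore] -/
theorem setLIntegral_ball_le_ulocEnergy (w : EuclideanSpace ℝ (Fin 3) → EuclideanSpace ℝ (Fin 3))
    (z : EuclideanSpace ℝ (Fin 3)) : ∫⁻ x in ball z 1, ‖w x‖ₑ ^ 2 ≤ ulocEnergy w :=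
  lintegral_ball_le_ulocEnergy w z

/-- The uniformly local energy is below the global energy. [folklore] -/
theorem ulocEnergy_le_lintegral (w : EuclideanSpace ℝ (Fin 3) → EuclideanSpace ℝ (Fin 3)) :
    ulocEnergy w ≤ ∫⁻ x, ‖w x‖ₑ ^ 2 :=
  iSup_le fun _ => setLIntegral_le_lintegral _ _

/-- **LINK 2 — the sliced local energy inequality under the Type-I rate is LINEAR in the uniformly
local energies, with `M`-only data, at unit scale** (typed here; PROVED in §M31(d), text N11g,
`slicedLinearLEIUnderRate_holds`).  There are absolute finite constants `A, B₁, B₂` such that for every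
classical Leray–Hopf solution on `[0, T)`, `T > 1`, with `|u(t,x)| ≤ M/√(T − t)` (`M ≥ 0`), every centre
`y` and EVERY time `t ∈ [T − 1, T)`:

  `∫_{B(y,1)} |u(t)|² ≤ A (M² + M³) + ∫_{T−1}^{t} (B₁ + B₂ · M/√(T − s)) · sup_z ∫_{B(z,1)} |u(s)|² ds`.

Proof route (§M31): for `t ≤ T − 1/2` the rate gives `|u(t)| ≤ M√2` pointwise, whence the bound with
`A = 2|B_1|`; for `t > T − 1/2` the sliced local energy inequality of the gauged classical pair
(`SereginSverak2002.isSuitableWeakSolutionOn_gauge_of_classical`, gauge `= p̃[u(s)] + c(s)`,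
`IsSuitableWeakSolutionOn.ae_localEnergy_slice_ennreal_of_forall_lt`) with the window cut-off
`ζ(s,x) = η(s − T) χ(x − y)` (`η = 1` on `[−1/2, 1/2]`, `supp η ⊆ (−1,1)`; `χ = 1` on `B_1`, `supp χ ⊆ B_2`):
the terms `|u|²(∂ₜζ + Δζ)` and `|u|² u·∇ζ` of the slice `s` are `≤ (2 + M/√(T−s)) M_ζ · 64 · sup_z ∫_{B(z,1)}|u(s)|²`
(averaging over unit balls, `64 = (3+1)³`), the gauge constant dies against `∫ u·∇ζ = 0` (`div u = 0`) and the
pressure term `2 p̃ u·∇ζ` is LINEAR by §M29(c) at `r = 3` (`K_b = M/√(T−s)`, `343 = (6+1)³`); Fubini on the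
SIGNED right-hand side, and every `t` (not only a.e.) by the continuity of `t ↦ ∫_{B̄(y,1)}|u(t)|²` for classical
solutions.  Every term carries at most ONE factor `‖u(s)‖_∞`, so the weight is integrable in `s`.
Sources in prose (a typed statement carries no cite tag): Caffarelli–Kohn–Nirenberg 1982 §2 (2.5); Jia–Šverák 2014
(3.3); Barker–Prange 2020 (arXiv:1812.09115) Theorem 2 and p. 5; Lemarié-Rieusset 2002 ch. 32 (uniformly local
energy estimates). -/
def SlicedLinearLEIUnderRate : Prop :=
  ∃ A B₁ B₂ : ℝ≥0∞, A ≠ ⊤ ∧ B₁ ≠ ⊤ ∧ B₂ ≠ ⊤ ∧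
    ∀ (M T : ℝ) (u : ℝ → EuclideanSpace ℝ (Fin 3) → EuclideanSpace ℝ (Fin 3))
      (p : ℝ → EuclideanSpace ℝ (Fin 3) → ℝ), 0 ≤ M → 1 < T →
      IsClassicalNSSolutionOn (Ico 0 T) 1 0 u p → IsLerayHopfOn T 1 0 (u 0) u →
      (∀ t ∈ Ioo 0 T, ∀ x, ‖u t x‖ ≤ M / Real.sqrt (T - t)) →
      ∀ (y : EuclideanSpace ℝ (Fin 3)) (t : ℝ), T - 1 ≤ t → t < T →
        ∫⁻ x in ball y 1, ‖u t x‖ₑ ^ 2 ≤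
          A * ENNReal.ofReal (M ^ 2 + M ^ 3) +
            ∫⁻ s in Ioo (T - 1) t,
              (B₁ + B₂ * ENNReal.ofReal (M / Real.sqrt (T - s))) * ulocEnergy (u s)

/-! ### §M30(b) LINK 3: Grönwall at unit scale -/

/-- Translation of lower integrals over `Ioo`: `∫_{]0,τ[} g(a + s) ds = ∫_{]a, a+τ[} g`. [folklore] -/
theorem setLIntegral_Ioo_comp_add_left (g : ℝ → ℝ≥0∞) (a τ : ℝ) :
    ∫⁻ s in Ioo 0 τ, g (a + s) = ∫⁻ s in Ioo a (a + τ), g s := by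
  have hmp : MeasurePreserving (fun s : ℝ => a + s) volume volume := measurePreserving_add_left volume a
  have hemb : MeasurableEmbedding fun s : ℝ => a + s := (Homeomorph.addLeft a).measurableEmbedding
  have h := hmp.setLIntegral_comp_preimage_emb hemb g (Ioo a (a + τ))
  rwa [Set.preimage_const_add_Ioo, sub_self, add_sub_cancel_left] at h

/-- The `L¹` norm of the Grönwall kernel on a window of unit length below `T`:
`∫_{]T−1, t[} (B₁ + B₂ M/√(T − s)) ds ≤ B₁ + B₂ · 2M` for `t ≤ T`, `M ≥ 0`. [folklore] -/
theorem lintegral_kernel_le {B₁ B₂ : ℝ≥0∞} {M T t : ℝ} (hM : 0 ≤ M) (ht : t ≤ T) :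
    ∫⁻ s in Ioo (T - 1) t, (B₁ + B₂ * ENNReal.ofReal (M / Real.sqrt (T - s))) ≤
      B₁ + B₂ * ENNReal.ofReal (2 * M) := by
  have hmeas : volume (Ioo (T - 1) t) ≤ 1 := by
    rw [Real.volume_Ioo]
    exact ENNReal.ofReal_le_one.2 (by linarith)
  have hker : ∫⁻ s in Ioo (T - 1) t, ENNReal.ofReal (M / Real.sqrt (T - s)) ≤ ENNReal.ofReal (2 * M) := by
    calc ∫⁻ s in Ioo (T - 1) t, ENNReal.ofReal (M / Real.sqrt (T - s))
        ≤ ∫⁻ s in Ioo (T - 1) t, ENNReal.ofReal M * ENNReal.ofReal ((T - s) ^ (-(1 / 2) : ℝ)) := by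
          refine setLIntegral_mono' measurableSet_Ioo fun s hs => ?_
          rw [← ENNReal.ofReal_mul hM]
          refine ENNReal.ofReal_le_ofReal ((rate_le_abs_mul_rpow (by linarith [hs.2])).trans_eq ?_)
          rw [abs_of_nonneg hM]
      _ = ENNReal.ofReal M * ∫⁻ s in Ioo (T - 1) t, ENNReal.ofReal ((T - s) ^ (-(1 / 2) : ℝ)) :=
          lintegral_const_mul' _ _ ENNReal.ofReal_ne_top
      _ ≤ ENNReal.ofReal M * ∫⁻ s in Ioo (T - 1 ^ 2) T, ENNReal.ofReal ((T - s) ^ (-(1 / 2) : ℝ)) :=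
          mul_le_mul' le_rfl (lintegral_mono_set (Ioo_subset_Ioo (by norm_num) ht))
      _ ≤ ENNReal.ofReal M * ENNReal.ofReal (2 * 1) :=
          mul_le_mul' le_rfl (lintegral_invSqrt_time_le le_rfl one_pos)
      _ = ENNReal.ofReal (2 * M) := by
          rw [← ENNReal.ofReal_mul hM]; ring_nf
  calc ∫⁻ s in Ioo (T - 1) t, (B₁ + B₂ * ENNReal.ofReal (M / Real.sqrt (T - s)))
      = (∫⁻ s in Ioo (T - 1) t, B₁) + ∫⁻ s in Ioo (T - 1) t, B₂ * ENNReal.ofReal (M / Real.sqrt (T - s)) :=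
        lintegral_add_left' aemeasurable_const _
    _ ≤ B₁ * 1 + B₂ * ENNReal.ofReal (2 * M) := by
        have hm : Measurable (fun s : ℝ => ENNReal.ofReal (M / Real.sqrt (T - s))) := by fun_prop
        rw [lintegral_const, lintegral_const_mul'' _ hm.aemeasurable]
        refine add_le_add ?_ (mul_le_mul' le_rfl hker)
        rw [Measure.restrict_apply_univ]
        exact mul_le_mul' le_rfl hmeas
    _ = B₁ + B₂ * ENNReal.ofReal (2 * M) := by rw [mul_one]

/-- **§M30(b) Grönwall at unit scale.**  Under LINK 2: for every classical Leray–Hopf solution on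
`[0, T)`, `T > 1`, with `|u| ≤ M/√(T − t)`, `M ≥ 0`, the uniformly local energy obeys
`sup_z ∫_{B(z,1)} |u(t)|² ≤ A (M² + M³) exp(B₁ + 2 B₂ M)` for every `t ∈ [T − 1, T)` — an `M`-ONLY
bound (Grönwall with the `L¹` kernel `B₁ + B₂ M/√(T − s)` on `[T−1, t]`, the tree's
`lintegral_gronwall_le` after translating time by `T − 1`; the qualitative finiteness
`sup_z ∫_{B(z,1)} |u(s)|² ≤ ∫ |u(s)|² ≤ 2E(u₀) < ∞` of the Leray–Hopf class closes the Grönwall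
loop but does not enter the constant). [cite: RobinsonRodrigoSadowski2016, Lemma A.25] [cite: BarkerPrange2020, Theorem 2] -/
theorem ulocEnergy_le_of_slicedLinearLEI {A B₁ B₂ : ℝ≥0∞} (hA : A ≠ ⊤) (hB₁ : B₁ ≠ ⊤) (hB₂ : B₂ ≠ ⊤)
    (hL : ∀ (M T : ℝ) (u : ℝ → EuclideanSpace ℝ (Fin 3) → EuclideanSpace ℝ (Fin 3))
      (p : ℝ → EuclideanSpace ℝ (Fin 3) → ℝ), 0 ≤ M → 1 < T →
      IsClassicalNSSolutionOn (Ico 0 T) 1 0 u p → IsLerayHopfOn T 1 0 (u 0) u →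
      (∀ t ∈ Ioo 0 T, ∀ x, ‖u t x‖ ≤ M / Real.sqrt (T - t)) →
      ∀ (y : EuclideanSpace ℝ (Fin 3)) (t : ℝ), T - 1 ≤ t → t < T →
        ∫⁻ x in ball y 1, ‖u t x‖ₑ ^ 2 ≤
          A * ENNReal.ofReal (M ^ 2 + M ^ 3) +
            ∫⁻ s in Ioo (T - 1) t,
              (B₁ + B₂ * ENNReal.ofReal (M / Real.sqrt (T - s))) * ulocEnergy (u s))
    {M T : ℝ} (hM : 0 ≤ M) (hT : 1 < T)
    {u : ℝ → EuclideanSpace ℝ (Fin 3) → EuclideanSpace ℝ (Fin 3)}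
    {p : ℝ → EuclideanSpace ℝ (Fin 3) → ℝ} (hcl : IsClassicalNSSolutionOn (Ico 0 T) 1 0 u p)
    (hLH : IsLerayHopfOn T 1 0 (u 0) u) (hrate : ∀ t ∈ Ioo 0 T, ∀ x, ‖u t x‖ ≤ M / Real.sqrt (T - t))
    {t : ℝ} (h1 : T - 1 ≤ t) (h2 : t < T) :
    ulocEnergy (u t) ≤ A * ENNReal.ofReal (M ^ 2 + M ^ 3) *
      ENNReal.ofReal (Real.exp (B₁.toReal + B₂.toReal * (2 * M))) := by
  -- the Grönwall unknown, kernel and data, translated to `[0, S]`, `S = t − (T − 1) < 1`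
  set a : ℝ → ℝ≥0∞ := fun σ => B₁ + B₂ * ENNReal.ofReal (M / Real.sqrt (T - (T - 1 + σ))) with ha
  set φ : ℝ → ℝ≥0∞ := fun σ => ulocEnergy (u (T - 1 + σ)) with hφ
  set Bc : ℝ≥0∞ := A * ENNReal.ofReal (M ^ 2 + M ^ 3) with hBc
  set S : ℝ := t - (T - 1) with hS
  have hS0 : 0 ≤ S := by rw [hS]; linarith
  have hS1 : S < 1 := by rw [hS]; linarith
  have hBct : Bc ≠ ⊤ := ENNReal.mul_ne_top hA ENNReal.ofReal_ne_top
  -- boundedness of the unknown by the energy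
  set E : ℝ≥0∞ := ENNReal.ofReal (2 * VectorCalculus.kineticEnergy (u 0)) with hE
  have hφE : ∀ σ ∈ Icc 0 S, φ σ ≤ E := fun σ hσ => by
    have hsI : T - 1 + σ ∈ Icc 0 T := ⟨by linarith [hσ.1], by linarith [hσ.2]⟩
    exact (ulocEnergy_le_lintegral _).trans (SereginSverak2002.eEnergy_le zero_le_one hLH hsI)
  -- the kernel is integrable
  have haS : ∫⁻ σ in Ioo 0 S, a σ ≠ ⊤ := by
    have h := setLIntegral_Ioo_comp_add_left
      (fun s => B₁ + B₂ * ENNReal.ofReal (M / Real.sqrt (T - s))) (T - 1) S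
    have hle := lintegral_kernel_le (B₁ := B₁) (B₂ := B₂) hM (show T - 1 + S ≤ T by linarith)
    rw [← h] at hle
    exact ne_top_of_le_ne_top (by
      exact ENNReal.add_ne_top.2 ⟨hB₁, ENNReal.mul_ne_top hB₂ ENNReal.ofReal_ne_top⟩) hle
  -- the Grönwall hypothesis from LINK 2, sup over centres, translated
  have hφG : ∀ σ ∈ Icc 0 S, φ σ ≤ Bc + ∫⁻ ρ in Ioo 0 σ, a ρ * φ ρ := by
    intro σ hσ
    have ht₁ : T - 1 ≤ T - 1 + σ := by linarith [hσ.1]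
    have ht₂ : T - 1 + σ < T := by linarith [hσ.2]
    refine iSup_le fun y => ?_
    refine (hL M T u p hM hT hcl hLH hrate y (T - 1 + σ) ht₁ ht₂).trans (le_of_eq ?_)
    congr 1
    exact (setLIntegral_Ioo_comp_add_left (fun s =>
      (B₁ + B₂ * ENNReal.ofReal (M / Real.sqrt (T - s))) * ulocEnergy (u s)) (T - 1) σ).symm
  have hG := lintegral_gronwall_le (S := S) hBct (by rw [hE]; exact ENNReal.ofReal_ne_top) hφE haS
    hφG S ⟨hS0, le_rfl⟩
  -- the exponent
  have hexp : (∫⁻ ρ in Ioo 0 S, a ρ).toReal ≤ B₁.toReal + B₂.toReal * (2 * M) := by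
    have h := setLIntegral_Ioo_comp_add_left
      (fun s => B₁ + B₂ * ENNReal.ofReal (M / Real.sqrt (T - s))) (T - 1) S
    have hle := lintegral_kernel_le (B₁ := B₁) (B₂ := B₂) hM (show T - 1 + S ≤ T by linarith)
    rw [← h] at hle
    have hfin : B₁ + B₂ * ENNReal.ofReal (2 * M) ≠ ⊤ :=
      ENNReal.add_ne_top.2 ⟨hB₁, ENNReal.mul_ne_top hB₂ ENNReal.ofReal_ne_top⟩
    refine (ENNReal.toReal_mono hfin hle).trans (le_of_eq ?_)
    rw [ENNReal.toReal_add hB₁ (ENNReal.mul_ne_top hB₂ ENNReal.ofReal_ne_top), ENNReal.toReal_mul,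
      ENNReal.toReal_ofReal (by positivity)]
  have htS : u t = u (T - 1 + S) := by rw [hS]; ring_nf
  calc ulocEnergy (u t) = φ S := by rw [hφ, htS]
    _ ≤ Bc * ENNReal.ofReal (Real.exp (∫⁻ ρ in Ioo 0 S, a ρ).toReal) := hG
    _ ≤ Bc * ENNReal.ofReal (Real.exp (B₁.toReal + B₂.toReal * (2 * M))) := by
        gcongr
    _ = _ := by rw [hBc]

/-! ### §M30(c) LINK 3: rescaling to unit scale — LINK 2 ⇒ door X″ -/

/-- The rescaled time interval: `{s | r² s ∈ [0, T)} = [0, T/r²)` for `r ≠ 0`. [folklore] -/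
theorem preimage_mul_sq_Ico {r T : ℝ} (hr : 0 < r) :
    (fun s : ℝ => r ^ 2 * s) ⁻¹' Ico 0 T = Ico 0 (T / r ^ 2) := by
  have hr2 : 0 < r ^ 2 := by positivity
  ext s
  simp only [mem_preimage, mem_Ico]
  rw [lt_div_iff₀ hr2, mul_comm s]
  constructor
  · rintro ⟨h0, h1⟩; exact ⟨(mul_nonneg_iff_of_pos_left hr2).1 h0, h1⟩
  · rintro ⟨h0, h1⟩; exact ⟨mul_nonneg hr2.le h0, h1⟩

/-- **The Type-I rate is scale invariant**: if `|u(t,x)| ≤ M/√(T − t)` on `(0, T)`, then the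
rescaled solution `u_r(s, y) = r u(r² s, r y)` obeys `|u_r(s,y)| ≤ M/√(T/r² − s)` on `(0, T/r²)`.
[cite: Leray1934, §20] -/
theorem rate_nsRescale {M T r : ℝ} (hr : 0 < r)
    {u : ℝ → EuclideanSpace ℝ (Fin 3) → EuclideanSpace ℝ (Fin 3)}
    (hrate : ∀ t ∈ Ioo 0 T, ∀ x, ‖u t x‖ ≤ M / Real.sqrt (T - t)) :
    ∀ s ∈ Ioo 0 (T / r ^ 2), ∀ x, ‖FluidPDE.nsRescale r u s x‖ ≤ M / Real.sqrt (T / r ^ 2 - s) := by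
  intro s hs x
  have hr2 : 0 < r ^ 2 := by positivity
  have hts : r ^ 2 * s ∈ Ioo 0 T := by
    refine ⟨mul_pos hr2 hs.1, ?_⟩
    have := hs.2; rwa [lt_div_iff₀ hr2, mul_comm] at this
  rw [nsRescale_apply, norm_smul, Real.norm_eq_abs, abs_of_pos hr]
  have h := hrate (r ^ 2 * s) hts (r • x)
  have hTs : 0 < T - r ^ 2 * s := by linarith [hts.2]
  have hsq : Real.sqrt (T / r ^ 2 - s) = Real.sqrt (T - r ^ 2 * s) / r := by
    rw [show T / r ^ 2 - s = (T - r ^ 2 * s) / r ^ 2 by field_simp, Real.sqrt_div' _ hr2.le, Real.sqrt_sq hr.le]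
  rw [hsq, div_div_eq_mul_div]
  calc r * ‖u (r ^ 2 * s) (r • x)‖ ≤ r * (M / Real.sqrt (T - r ^ 2 * s)) :=
        mul_le_mul_of_nonneg_left h hr.le
    _ = M * r / Real.sqrt (T - r ^ 2 * s) := by ring

/-- **Ball energies under rescaling**: `∫_{B(y,r)} |u(t)|² = r ∫_{B(y/r, 1)} |u_r(t/r²)|²`, i.e.
for `t = r² s`, `∫⁻_{B(y,r)} ‖u(t)‖ₑ² = r · ∫⁻_{B(r⁻¹y,1)} ‖u_r(s)‖ₑ²`. [cite: Leray1934, §20] -/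
theorem setLIntegral_ball_eq_nsRescale {r : ℝ} (hr : 0 < r)
    (u : ℝ → EuclideanSpace ℝ (Fin 3) → EuclideanSpace ℝ (Fin 3)) (s : ℝ)
    (y : EuclideanSpace ℝ (Fin 3)) :
    ∫⁻ x in ball y r, ‖u (r ^ 2 * s) x‖ₑ ^ 2 =
      ENNReal.ofReal r * ∫⁻ x in ball (r⁻¹ • y) 1, ‖FluidPDE.nsRescale r u s x‖ₑ ^ 2 := by
  have hpre : (fun x : EuclideanSpace ℝ (Fin 3) => (0 : EuclideanSpace ℝ (Fin 3)) + r • x) ⁻¹' ball y r =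
      ball (r⁻¹ • y) 1 := by
    ext x
    rw [mem_preimage, zero_add, mem_ball, mem_ball, dist_eq_norm, dist_eq_norm,
      show r • x - y = r • (x - r⁻¹ • y) by rw [smul_sub, smul_inv_smul₀ hr.ne'], norm_smul,
      Real.norm_eq_abs, abs_of_pos hr]
    constructor
    · intro h; nlinarith [norm_nonneg (x - r⁻¹ • y)]
    · intro h; nlinarith [norm_nonneg (x - r⁻¹ • y)]
  have hcov := setLIntegral_preimage_comp_space_affine hr (0 : EuclideanSpace ℝ (Fin 3))
    (fun x => ‖u (r ^ 2 * s) x‖ₑ ^ 2) (ball y r)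
  rw [hpre, finrank_euclideanSpace_fin] at hcov
  simp only [zero_add] at hcov
  -- `‖u_r(s, x)‖ₑ² = r² ‖u(r² s, r x)‖ₑ²`
  have hpt : ∀ x : EuclideanSpace ℝ (Fin 3), ‖FluidPDE.nsRescale r u s x‖ₑ ^ 2 =
      ENNReal.ofReal (r ^ 2) * ‖u (r ^ 2 * s) (r • x)‖ₑ ^ 2 := fun x => by
    rw [nsRescale_apply, enorm_smul, mul_pow, Real.enorm_eq_ofReal hr.le, ENNReal.ofReal_pow hr.le]
  simp_rw [hpt]
  rw [lintegral_const_mul' _ _ ENNReal.ofReal_ne_top, hcov, ← mul_assoc, ← mul_assoc,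
    ← ENNReal.ofReal_mul hr.le, ← ENNReal.ofReal_mul (by positivity)]
  have hr3 : r * r ^ 2 * (r ^ 3)⁻¹ = 1 := by field_simp
  rw [hr3, ENNReal.ofReal_one, one_mul]

/-- **§M30(c) LINK 3: LINK 2 ⇒ door X″.**  If the sliced linear local energy inequality under the
rate holds at unit scale (`SlicedLinearLEIUnderRate`), then door X″ `UlocMorreyBoundSupTypeI`
holds: for every `M` there is `K = K(M)` with `∫_{B(y,r)} |u(t)|² ≤ K r` for every classical
Leray–Hopf solution on `[0,T)` with `|u| ≤ M/√(T − t)`, all `y`, `0 < r`, `r² < T` and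
`t ∈ (T − r², T)` — by rescaling `u ↦ r u(r² ·, r ·)` to unit scale (`T ↦ T/r² > 1`, same `M`:
`IsClassicalNSSolutionOn.nsRescale_holds`, `isLerayHopfOn_nsRescale`, `rate_nsRescale`) and the
Grönwall bound (b); explicitly `K(M) = A (M₊² + M₊³) exp(B₁ + 2 B₂ M₊)`, `M₊ = max M 0`.  The
conclusion is literally the body of `UlocMorreyBoundSupTypeI` (N10c §M28(i)). [cite: BarkerPrange2020, Theorem 2 and p. 5] [cite: Leray1934, §20] -/
theorem ulocMorreyBound_of_slicedLinearLEI (hLink : SlicedLinearLEIUnderRate) :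
    ∀ M : ℝ, ∃ K : ℝ, ∀ (T : ℝ) (u : ℝ → EuclideanSpace ℝ (Fin 3) → EuclideanSpace ℝ (Fin 3))
      (p : ℝ → EuclideanSpace ℝ (Fin 3) → ℝ), 0 < T →
      IsClassicalNSSolutionOn (Ico 0 T) 1 0 u p → IsLerayHopfOn T 1 0 (u 0) u →
      (∀ t ∈ Ioo 0 T, ∀ x, ‖u t x‖ ≤ M / Real.sqrt (T - t)) →
      ∀ (y : EuclideanSpace ℝ (Fin 3)) (r : ℝ), 0 < r → r ^ 2 < T →
        ∀ t : ℝ, T - r ^ 2 < t → t < T → ∫ x in ball y r, ‖u t x‖ ^ 2 ≤ K * r := by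
  obtain ⟨A, B₁, B₂, hA, hB₁, hB₂, hL⟩ := hLink
  intro M
  set Mp : ℝ := max M 0 with hMp
  have hMp0 : 0 ≤ Mp := le_max_right _ _
  set K₀ : ℝ≥0∞ := A * ENNReal.ofReal (Mp ^ 2 + Mp ^ 3) *
    ENNReal.ofReal (Real.exp (B₁.toReal + B₂.toReal * (2 * Mp))) with hK₀
  have hK₀t : K₀ ≠ ⊤ :=
    ENNReal.mul_ne_top (ENNReal.mul_ne_top hA ENNReal.ofReal_ne_top) ENNReal.ofReal_ne_top
  refine ⟨K₀.toReal, fun T u p hT hcl hLH hrate y r hr hrT t ht1 ht2 => ?_⟩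
  have hr2 : 0 < r ^ 2 := by positivity
  -- the rate with `M₊ ≥ 0`
  have hrate' : ∀ t ∈ Ioo 0 T, ∀ x, ‖u t x‖ ≤ Mp / Real.sqrt (T - t) := fun t ht x =>
    (hrate t ht x).trans (div_le_div_of_nonneg_right (le_max_left _ _) (Real.sqrt_nonneg _))
  -- the rescaled solution at unit scale
  set v := FluidPDE.nsRescale r u with hv
  have hT' : 1 < T / r ^ 2 := by rwa [lt_div_iff₀ hr2, one_mul]
  have hcl' : IsClassicalNSSolutionOn (Ico 0 (T / r ^ 2)) 1 0 v (nsRescalePressure r p) := by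
    have h := IsClassicalNSSolutionOn.nsRescale_holds hcl hr
    rwa [preimage_mul_sq_Ico hr, nsRescaleForce_zero] at h
  have hLH' : IsLerayHopfOn (T / r ^ 2) 1 0 (v 0) v := by
    have h := isLerayHopfOn_nsRescale hLH hr
    rwa [nsRescaleForce_zero, ← nsRescale_zero_time] at h
  have hratev := rate_nsRescale hr hrate'
  -- the rescaled time `s = t/r²` lies in the last unit window
  set s : ℝ := t / r ^ 2 with hs
  have hts : r ^ 2 * s = t := by rw [hs]; field_simp
  have hs1 : T / r ^ 2 - 1 ≤ s := by
    rw [hs, div_sub_one hr2.ne', div_le_div_iff_of_pos_right hr2]; linarith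
  have hs2 : s < T / r ^ 2 := by rw [hs]; exact div_lt_div_of_pos_right ht2 hr2
  have hG := ulocEnergy_le_of_slicedLinearLEI hA hB₁ hB₂ hL hMp0 hT' hcl' hLH' hratev hs1 hs2
  -- back to scale `r`
  have hball : ∫⁻ x in ball y r, ‖u t x‖ₑ ^ 2 ≤ ENNReal.ofReal r * K₀ := by
    rw [← hts, setLIntegral_ball_eq_nsRescale hr u s y]
    exact mul_le_mul' le_rfl ((setLIntegral_ball_le_ulocEnergy _ _).trans hG)
  -- the real integral
  have htI : t ∈ Icc 0 T := ⟨by nlinarith [ht1, hrT], ht2.le⟩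
  have hmem : MemLp (u t) 2 volume := hLH.memLp t htI
  have hint : IntegrableOn (fun x => ‖u t x‖ ^ 2) (ball y r) volume :=
    (hmem.integrable_norm_pow two_ne_zero).integrableOn
  rw [integral_eq_lintegral_of_nonneg_ae (Eventually.of_forall fun x => sq_nonneg _)
    hint.aestronglyMeasurable]
  have e : ∫⁻ x in ball y r, ENNReal.ofReal (‖u t x‖ ^ 2) = ∫⁻ x in ball y r, ‖u t x‖ₑ ^ 2 :=
    lintegral_congr fun x => by rw [← ofReal_norm, ENNReal.ofReal_pow (norm_nonneg _)]
  rw [e]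
  calc (∫⁻ x in ball y r, ‖u t x‖ₑ ^ 2).toReal ≤ (ENNReal.ofReal r * K₀).toReal :=
        ENNReal.toReal_mono (ENNReal.mul_ne_top ENNReal.ofReal_ne_top hK₀t) hball
    _ = K₀.toReal * r := by rw [ENNReal.toReal_mul, ENNReal.toReal_ofReal hr.le, mul_comm]

end Summit.NavierStokesRegularity.NavierStokesRegularity.Theorems.StrainDoors

end
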